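import Summits.RiemannHypothesis.RiemannHypothesis.Theorems.OddSectorOddOneSignedWindowsEnergyFloorCore
import Summits.RiemannHypothesis.RiemannHypothesis.Theorems.OddSectorOddOneSignedWindowsTightBlockNonneg
import HarnessLib

/-!
# RH ⟺ cofinal non-negativity of the odd ground energy; relative tightness at cofinal heights ⇒ RH

Strength certificate of line `SketchIdeator5` of crux `OddSector.OddOneSignedWindows`
(stmt-RiemannHypothesis-17778), in `let`-free form (registered helper `stub_cofinalNonneg_iff_riemannHypothesis`).

* `stub_cofinalNonneg_iff_riemannHypothesis`: `RH ↔ ∀ B, ∃ a ≥ B, 0 ≤ ε_od(a)` — the landed odd criterion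
  `riemannHypothesis_iff_forall_weilOddGroundEnergy_nonneg` (`RH ↔ ∀ a > 0, 0 ≤ ε_od(a)`) made cofinal by the
  antitonicity of `ε_od` (`weilOddGroundEnergy_antitone`, Bombieri 2000 Thm 5). Clause (o) (`0 < ε_od(a)`) of the
  line's RH-strength stub K1 (`stub_tightBlockEventually`, v4) at the cofinal non-resonant heights of the landed
  `stub_nonResonantCofinal` is therefore already RH: K1 ⇒ RH.
* `riemannHypothesis_of_cofinal_relTight`: clause (i) of K1 ALONE is RH too — if at cofinal heights every `L²`-normalised
  smooth odd window test has `Re Q ≥ ε_od(a)/(1+θ)` for some `θ > 0` (which is what "every admissible energy lower bound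
  `R` of the block improves to `R/(1+θ)`" says at the admissible choice `R := ε_od(a)`), then `0 ≤ ε_od(a)` there
  (`nonneg_of_div_one_add_le_self`, `le_weilOddGroundEnergy_of_forall`, landed with `stub_tightBlockNonneg`), hence RH.
-/

noncomputable section

set_option linter.dupNamespace false

open Complex Filter Set MeasureTheory
open scoped Real Topology

namespace Summit.RiemannHypothesis.RiemannHypothesis.Theorems.OddSector

open Literature.NumberTheory.LFunctions

/-- **RH ⟺ the odd ground energy is non-negative at cofinal heights.** Forward: RH gives `0 ≤ ε_od(a)` at
every window (`riemannHypothesis_iff_forall_weilOddGroundEnergy_nonneg'`). Backward: given `b > 0`, pick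
`a ≥ b` with `0 ≤ ε_od(a)`; `ε_od` is non-increasing (`weilOddGroundEnergy_antitone`), so `0 ≤ ε_od(a) ≤ ε_od(b)`,
and `RH` follows from the odd criterion `riemannHypothesis_iff_forall_weilOddGroundEnergy_nonneg`. -/
theorem stub_cofinalNonneg_iff_riemannHypothesis :
    _root_.RiemannHypothesis ↔ ∀ B : ℝ, ∃ a : ℝ, B ≤ a ∧ 0 ≤ weilOddGroundEnergy a := by
  constructor
  · intro hRH B
    exact ⟨B, le_rfl, (riemannHypothesis_iff_forall_weilOddGroundEnergy_nonneg'.1 hRH) B⟩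
  · intro h
    rw [riemannHypothesis_iff_forall_weilOddGroundEnergy_nonneg]
    intro b hb
    obtain ⟨a, hba, ha⟩ := h b
    exact ha.trans (weilOddGroundEnergy_antitone hb hba)

/-- Cofinal POSITIVITY of `ε_od` (clause (o) of the line's K1 at cofinal heights) implies RH. -/
theorem riemannHypothesis_of_cofinal_pos
    (h : ∀ B : ℝ, ∃ a : ℝ, B ≤ a ∧ 0 < weilOddGroundEnergy a) : _root_.RiemannHypothesis :=
  stub_cofinalNonneg_iff_riemannHypothesis.2 fun B => by
    obtain ⟨a, hBa, ha⟩ := h B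
    exact ⟨a, hBa, ha.le⟩

/-- **Relative tightness at cofinal heights ⇒ RH** (clause (i) of K1 alone, at the admissible choice `R := ε_od(a)`):
if beyond every height some window `a` and some `θ > 0` have `ε_od(a)/(1+θ) ≤ Re Q(h)` for every `L²`-normalised
smooth odd test `h` supported in `[-a, a]`, then RH. Indeed `ε_od(a)/(1+θ) ≤ ε_od(a)` forces `0 ≤ ε_od(a)`
(`le_weilOddGroundEnergy_of_forall` + `nonneg_of_div_one_add_le_self`; for `a ≤ 0` the junk value is `0`). -/
theorem riemannHypothesis_of_cofinal_relTight
    (h : ∀ B : ℝ, ∃ a : ℝ, B ≤ a ∧ ∃ θ : ℝ, 0 < θ ∧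
      ∀ g : ℝ → ℂ, IsWeilTest g → tsupport g ⊆ Icc (-a) a → (∀ t, g (-t) = -g t) →
        ∫ t, ‖g t‖ ^ 2 = (1 : ℝ) → weilOddGroundEnergy a / (1 + θ) ≤ (weilQuadratic g).re) :
    _root_.RiemannHypothesis := by
  refine stub_cofinalNonneg_iff_riemannHypothesis.2 fun B => ?_
  obtain ⟨a, hBa, θ, hθ, hrel⟩ := h B
  refine ⟨a, hBa, ?_⟩
  rcases le_or_gt a 0 with ha | ha
  · exact (weilOddGroundEnergy_of_nonpos ha).ge
  · exact nonneg_of_div_one_add_le_self hθ (le_weilOddGroundEnergy_of_forall ha hrel)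

end Summit.RiemannHypothesis.RiemannHypothesis.Theorems.OddSector

end
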